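import Summits.Ventures.PercRepro.ProfilePointedCircuitClassesStarSharpParA
import Summits.Ventures.PercRepro.ProfilePointedCircuitClassesStarSharpDefectD

/-!
# PercRepro — THE REGIME `b ∥ y`, `y ∈ X`, OF CASE D0: THE STRUCTURE OF THE BAD DEMANDS
(p5, gen 55; `proofs/P5-GM1.md` §82 ADD 7)

If `b` is parallel to a point `y` of `X` in `N ／ b′` (`ρ{y, b, b′} = 2`, `ρ{b, b′} = 2`), a set is ON iff `y` lies in
its closure.  The bad demands (`¬c0 ∧ ¬(c1 ∧ c2)`) split by `c1`: a bad demand with a bi-independent swap has `c1`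
(`parX_c1_of_swap`), so the bad demands without `c1` are defects of `R` (`parX_no_swap_of_not_c1`); a bad demand
with `c1` does not contain `y` (`parX_not_mem_of_c1`) and its endpoints are off the line `ef` (`parX_off_line_of_c1`);
an OFF C-point (`y ∉ cl{e, f, x}`) is an endpoint of at most one bad demand (`parX_private`): not of a bad demand
without `c1`, and not of two distinct bad demands with `c1`.
-/

open scoped Matroid

namespace PercRepro.Cogirth

open Finset ThmH Skew Shadow Profile

open Classical

variable {α : Type} [DecidableEq α] {N : Matroid α} [N.Finite]

section StarSharpParXA

variable {b b' : α}

/-- In the regime `b ∥ y`: a bad demand whose swap is bi-independent has `c1` (`ρ(π + e + f) = 4`). -/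
theorem parX_c1_of_swap (hn : (gr N).card = 9) (h : SeriesPair N b b') {e f : α} (he : e ∈ gr N) (hf : f ∈ gr N)
    (hef : e ≠ f) (heb : e ≠ b) (heb' : e ≠ b') (hfb : f ≠ b) (hfb' : f ≠ b')
    (he1 : ∀ y ∈ ((((gr N).erase b).erase b').erase f).erase e, rk N {e, y} = 2)
    {y : α} (hyX : y ∈ ((((gr N).erase b).erase b').erase f).erase e) (hpar : rk N {y, b, b'} = 2)
    (hbb2 : rk N {b, b'} = 2) {W : Finset α} (hW : W ∈ d0DON N b' e f) (hc0 : ¬ d0c0 N b b' e f W)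
    (hswap : rk N (insert f ((W.erase b).erase e)) = 3 ∧
      rk N (insert e (((((gr N).erase b).erase b').erase f).erase e \ (W.erase b).erase e)) = 4) :
    d0c1 N b e f W := by
  have hXE : ((((gr N).erase b).erase b').erase f).erase e ⊆ ((gr N).erase b).erase b' :=
    (erase_subset _ _).trans (erase_subset _ _)
  have hXg : ((((gr N).erase b).erase b').erase f).erase e ⊆ gr N :=
    hXE.trans ((erase_subset _ _).trans (erase_subset _ _))
  have hfE : f ∈ ((gr N).erase b).erase b' := mem_erase.2 ⟨hfb', mem_erase.2 ⟨hfb, hf⟩⟩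
  have heE : e ∈ ((gr N).erase b).erase b' := mem_erase.2 ⟨heb', mem_erase.2 ⟨heb, he⟩⟩
  have hy1 : rk N ({y} : Finset α) = 1 := by
    have h1 := rk_insert_le_add_one (N := N) he (X := ({y} : Finset α)) (singleton_subset_iff.2 (hXg hyX))
    have h2 := rk_le_card' (M := N) ({y} : Finset α)
    rw [card_singleton] at h2
    rw [he1 y hyX] at h1
    omega
  have hWd := hW
  simp only [d0DON, mem_filter] at hWd
  obtain ⟨-, hπX, -, -, -, hπe, -, hon⟩ := d0_demand_data h hn hf hef heb hfb hfb' (e := e) W hWd.1 hWd.2.1 hWd.2.2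
  -- `y ∈ cl(π + e)`
  have hyπe : rk N (insert y (insert e ((W.erase b).erase e))) = rk N (insert e ((W.erase b).erase e)) :=
    (on_iff_of_parallel h (hXE hyX) hy1 hpar hbb2 (insert_subset heE (hπX.trans hXE))).1 (by rw [hπe]; exact hon)
  unfold d0c1
  by_contra hc1
  -- `e ∈ cl(π + f)`, hence `y ∈ cl(π + f)` and the swap is ON: `c0`
  have h1 := rk_insert_le_add_one (N := N) he (X := insert f ((W.erase b).erase e))
    (insert_subset hf (hπX.trans hXg))
  have h2 : rk N (insert f ((W.erase b).erase e)) ≤ rk N (insert e (insert f ((W.erase b).erase e))) :=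
    rk_mono' (subset_insert _ _)
  rw [insert_f_insert_e_comm] at hc1
  rw [hswap.1] at h1 h2
  have h3 : rk N (insert e (insert f ((W.erase b).erase e))) = 3 := by omega
  have h4 : rk N (insert y (insert e (insert f ((W.erase b).erase e)))) =
      rk N (insert e (insert f ((W.erase b).erase e))) :=
    rk_insert_eq_of_rk_insert_eq_subset' (N := N) (S := insert e ((W.erase b).erase e))
      (S' := insert e (insert f ((W.erase b).erase e))) (w := y)
      (insert_subset_insert _ (subset_insert _ _)) hyπe
  have h5 : rk N (insert y (insert f ((W.erase b).erase e))) ≤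
      rk N (insert y (insert e (insert f ((W.erase b).erase e)))) :=
    rk_mono' (insert_subset_insert _ (subset_insert _ _))
  have h6 : rk N (insert f ((W.erase b).erase e)) ≤ rk N (insert y (insert f ((W.erase b).erase e))) :=
    rk_mono' (subset_insert _ _)
  rw [h4, h3] at h5
  rw [hswap.1] at h6
  have h7 : rk N (insert y (insert f ((W.erase b).erase e))) = rk N (insert f ((W.erase b).erase e)) := by
    rw [hswap.1]; omega
  have h8 := (on_iff_of_parallel h (hXE hyX) hy1 hpar hbb2 (insert_subset hfE (hπX.trans hXE))).2 h7
  rw [hswap.1] at h8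
  exact hc0 ⟨hswap.1, hswap.2, h8⟩

/-- In the regime `b ∥ y`: a bad demand without `c1` has no swap in `R` (it is a defect of `R`). -/
theorem parX_no_swap_of_not_c1 (hn : (gr N).card = 9) (h : SeriesPair N b b') {e f : α} (he : e ∈ gr N)
    (hf : f ∈ gr N) (hef : e ≠ f) (heb : e ≠ b) (heb' : e ≠ b') (hfb : f ≠ b) (hfb' : f ≠ b')
    (he1 : ∀ y ∈ ((((gr N).erase b).erase b').erase f).erase e, rk N {e, y} = 2)
    {y : α} (hyX : y ∈ ((((gr N).erase b).erase b').erase f).erase e) (hpar : rk N {y, b, b'} = 2)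
    (hbb2 : rk N {b, b'} = 2) {W : Finset α} (hW : W ∈ d0DON N b' e f) (hc0 : ¬ d0c0 N b b' e f W)
    (hc1 : ¬ d0c1 N b e f W) :
    ¬ (rk N (insert f ((W.erase b).erase e)) = 3 ∧
      rk N (insert e (((((gr N).erase b).erase b').erase f).erase e \ (W.erase b).erase e)) = 4) :=
  fun hswap => hc1 (parX_c1_of_swap hn h he hf hef heb heb' hfb hfb' he1 hyX hpar hbb2 hW hc0 hswap)

/-- In the regime `b ∥ y`: a bad demand with `c1` does not contain `y`. -/
theorem parX_not_mem_of_c1 (hn : (gr N).card = 9) (h : SeriesPair N b b') {e f : α} (he : e ∈ gr N) (hf : f ∈ gr N)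
    (hef : e ≠ f) (heb : e ≠ b) (heb' : e ≠ b') (hfb : f ≠ b) (hfb' : f ≠ b')
    (he1 : ∀ y ∈ ((((gr N).erase b).erase b').erase f).erase e, rk N {e, y} = 2)
    (hfc : ∀ y ∈ ((((gr N).erase b).erase b').erase f).erase e, rk N (((((gr N).erase b).erase b').erase f).erase y) = 4)
    {y : α} (hyX : y ∈ ((((gr N).erase b).erase b').erase f).erase e) (hpar : rk N {y, b, b'} = 2)
    (hbb2 : rk N {b, b'} = 2) {W : Finset α} (hW : W ∈ d0DON N b' e f) (hc0 : ¬ d0c0 N b b' e f W)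
    (hc1 : d0c1 N b e f W) (hc2 : ¬ d0c2 N b b' e f W) : y ∉ (W.erase b).erase e := by
  intro hyπ
  have hXE : ((((gr N).erase b).erase b').erase f).erase e ⊆ ((gr N).erase b).erase b' :=
    (erase_subset _ _).trans (erase_subset _ _)
  have hXg : ((((gr N).erase b).erase b').erase f).erase e ⊆ gr N :=
    hXE.trans ((erase_subset _ _).trans (erase_subset _ _))
  have hfE : f ∈ ((gr N).erase b).erase b' := mem_erase.2 ⟨hfb', mem_erase.2 ⟨hfb, hf⟩⟩
  have hy1 : rk N ({y} : Finset α) = 1 := by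
    have h1 := rk_insert_le_add_one (N := N) he (X := ({y} : Finset α)) (singleton_subset_iff.2 (hXg hyX))
    have h2 := rk_le_card' (M := N) ({y} : Finset α)
    rw [card_singleton] at h2
    rw [he1 y hyX] at h1
    omega
  have hWd := hW
  simp only [d0DON, mem_filter] at hWd
  obtain ⟨-, hπX, hπ2, -, -, hπe, hYf, -⟩ := d0_demand_data h hn hf hef heb hfb hfb' (e := e) W hWd.1 hWd.2.1 hWd.2.2
  -- the swap `π + f` is ON (`y ∈ π`), so it is not bi-independent: `ρ(π + f) = 3` (from `c1`) and `e ∈ cl(X − π)`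
  have hswon : rk N (insert b (insert b' (insert f ((W.erase b).erase e)))) =
      rk N (insert f ((W.erase b).erase e)) + 1 := by
    rw [on_iff_of_parallel h (hXE hyX) hy1 hpar hbb2 (insert_subset hfE (hπX.trans hXE)),
      insert_eq_of_mem (mem_insert_of_mem hyπ)]
  unfold d0c1 at hc1
  have h1 := rk_insert_le_add_one (N := N) he (X := insert f ((W.erase b).erase e))
    (insert_subset hf (hπX.trans hXg))
  have h2 := rk_le_card' (M := N) (insert f ((W.erase b).erase e))
  have h3 : (insert f ((W.erase b).erase e)).card ≤ 3 := by
    have := card_insert_le f ((W.erase b).erase e)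
    omega
  rw [insert_f_insert_e_comm] at hc1
  have hπf : rk N (insert f ((W.erase b).erase e)) = 3 := by omega
  rw [hπf] at hswon
  have hτe : rk N (insert e (((((gr N).erase b).erase b').erase f).erase e \ (W.erase b).erase e)) ≠ 4 :=
    fun h' => hc0 ⟨hπf, h', hswon⟩
  have hτ3 := d0_S3 h hn he hf hef heb heb' hfb hfb' _ hπX hπ2 hYf
  have h4 := rk_insert_le_add_one (N := N) he (X := ((((gr N).erase b).erase b').erase f).erase e \ (W.erase b).erase e)
    (sdiff_subset.trans hXg)
  have h5 : rk N (((((gr N).erase b).erase b').erase f).erase e \ (W.erase b).erase e) ≤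
      rk N (insert e (((((gr N).erase b).erase b').erase f).erase e \ (W.erase b).erase e)) :=
    rk_mono' (subset_insert _ _)
  have hB1 : rk N (insert e (((((gr N).erase b).erase b').erase f).erase e \ (W.erase b).erase e)) = 3 := by omega
  -- the other endpoint `q`: `(X + e) − q ⊆ cl(X − π)` (it is `(X − π) + y + e`), against `hfc`
  obtain ⟨q, hqπ, hqy⟩ := exists_mem_ne (by omega : 1 < ((W.erase b).erase e).card) y
  have hπeq : (W.erase b).erase e = {y, q} := eq_pair_of_card_two hπ2 hyπ hqπ hqy.symm
  have hqX := hπX hqπ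
  have hsub : insert e ((((((gr N).erase b).erase b').erase f).erase e).erase q) ⊆
      insert e (insert y (((((gr N).erase b).erase b').erase f).erase e \ (W.erase b).erase e)) := by
    intro u hu
    rw [mem_insert] at hu ⊢
    rcases hu with rfl | hu
    · exact Or.inl rfl
    right
    rw [mem_insert, mem_sdiff, hπeq, mem_insert, mem_singleton]
    by_cases huy : u = y
    · exact Or.inl huy
    · exact Or.inr ⟨(mem_erase.1 hu).2, by push Not; exact ⟨huy, (mem_erase.1 hu).1⟩⟩
  have h6 : rk N (insert e ((((((gr N).erase b).erase b').erase f).erase e).erase q)) ≤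
      rk N (insert e (insert y (((((gr N).erase b).erase b').erase f).erase e \ (W.erase b).erase e))) := rk_mono' hsub
  rw [insert_e_X_erase_eq he hef heb heb' hqX, hfc q hqX] at h6
  -- `¬c2`: the complement is ON, so `y ∈ cl(X − π)`
  have hτE : ((((gr N).erase b).erase b').erase f).erase e \ (W.erase b).erase e ⊆ ((gr N).erase b).erase b' :=
    sdiff_subset.trans hXE
  have hycl : rk N (insert y (((((gr N).erase b).erase b').erase f).erase e \ (W.erase b).erase e)) =
      rk N (((((gr N).erase b).erase b').erase f).erase e \ (W.erase b).erase e) := by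
    rw [← on_iff_of_parallel h (hXE hyX) hy1 hpar hbb2 hτE]
    unfold d0c2 at hc2
    have h9 := rk_insert_bb'_bounds h hτE
    rw [hτ3] at h9 ⊢
    omega
  have h7 : rk N (insert e (insert y (((((gr N).erase b).erase b').erase f).erase e \ (W.erase b).erase e))) ≤ 3 := by
    rw [insert_comm]
    have h8 := rk_insert_eq_of_rk_insert_eq_subset' (N := N)
      (S := ((((gr N).erase b).erase b').erase f).erase e \ (W.erase b).erase e)
      (S' := insert e (((((gr N).erase b).erase b').erase f).erase e \ (W.erase b).erase e)) (w := y)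
      (subset_insert _ _) hycl
    rw [h8, hB1]
  omega

/-- A bad demand with `c1`: its endpoints are off the line `ef`. -/
theorem parX_off_line_of_c1 (hn : (gr N).card = 9) (h : SeriesPair N b b') {e f : α} (he : e ∈ gr N) (hf : f ∈ gr N)
    (hef : e ≠ f) (heb : e ≠ b) (hfb : f ≠ b) (hfb' : f ≠ b')
    (hf1 : ∀ y ∈ ((((gr N).erase b).erase b').erase f).erase e, rk N {f, y} = 2)
    {W : Finset α} (hW : W ∈ d0DON N b' e f) (hc1 : d0c1 N b e f W) {x : α} (hx : x ∈ (W.erase b).erase e) :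
    rk N {e, f, x} = 3 := by
  have hXg : ((((gr N).erase b).erase b').erase f).erase e ⊆ gr N :=
    (erase_subset _ _).trans ((erase_subset _ _).trans ((erase_subset _ _).trans (erase_subset _ _)))
  have hWd := hW
  simp only [d0DON, mem_filter] at hWd
  obtain ⟨-, hπX, -, -, -, -, -, -⟩ := d0_demand_data h hn hf hef heb hfb hfb' (e := e) W hWd.1 hWd.2.1 hWd.2.2
  have hxX := hπX hx
  by_contra hne
  have h1 : rk N (insert e {f, x}) ≤ 3 := by
    have := rk_insert_le_add_one (N := N) he (X := {f, x}) (insert_subset hf (singleton_subset_iff.2 (hXg hxX)))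
    rw [hf1 x hxX] at this
    exact this
  have h2 : rk N {f, x} ≤ rk N (insert e {f, x}) := rk_mono' (subset_insert _ _)
  rw [hf1 x hxX] at h2
  rw [← triple_eq_insert_last, triple_rot'] at h1 h2 hne
  have h3 : rk N (insert e {f, x}) = rk N {f, x} := by rw [hf1 x hxX, ← triple_eq_insert_last, triple_rot']; omega
  have h4 := rk_insert_eq_of_rk_insert_eq_subset' (N := N) (S := {f, x}) (S' := insert f ((W.erase b).erase e)) (w := e)
    (by
      intro u hu; simp only [mem_insert, mem_singleton] at hu
      rcases hu with rfl | rfl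
      · exact mem_insert_self _ _
      · exact mem_insert_of_mem hx) h3
  unfold d0c1 at hc1
  rw [insert_f_insert_e_comm, h4] at hc1
  have h5 := rk_le_card' (M := N) (insert f ((W.erase b).erase e))
  have h6 := card_insert_le f ((W.erase b).erase e)
  have hπ2 : ((W.erase b).erase e).card = 2 :=
    (d0_demand_data h hn hf hef heb hfb hfb' (e := e) W hWd.1 hWd.2.1 hWd.2.2).2.2.1
  omega

/-- **PRIVACY OF THE OFF C-POINTS** (regime `b ∥ y`): a point `x` of `X` off the line `ef` with `y ∉ cl{e, f, x}` is
an endpoint of at most one bad demand — of none without `c1`, and of at most one with `c1`. -/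
theorem parX_private (hn : (gr N).card = 9) (h : SeriesPair N b b') {e f : α} (he : e ∈ gr N) (hf : f ∈ gr N)
    (hef : e ≠ f) (heb : e ≠ b) (heb' : e ≠ b') (hfb : f ≠ b) (hfb' : f ≠ b')
    (he1 : ∀ y ∈ ((((gr N).erase b).erase b').erase f).erase e, rk N {e, y} = 2)
    (hfc : ∀ y ∈ ((((gr N).erase b).erase b').erase f).erase e, rk N (((((gr N).erase b).erase b').erase f).erase y) = 4)
    {y : α} (hyX : y ∈ ((((gr N).erase b).erase b').erase f).erase e) (hpar : rk N {y, b, b'} = 2)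
    (hbb2 : rk N {b, b'} = 2) {x : α} (hxX : x ∈ ((((gr N).erase b).erase b').erase f).erase e)
    (hefx : rk N {e, f, x} = 3) (hoff : rk N (insert y {e, f, x}) = 4)
    {W W' : Finset α} (hW : W ∈ d0DON N b' e f) (hc0 : ¬ d0c0 N b b' e f W) (hc1 : d0c1 N b e f W)
    (hc2 : ¬ d0c2 N b b' e f W) (hxW : x ∈ (W.erase b).erase e)
    (hW' : W' ∈ d0DON N b' e f) (hc0' : ¬ d0c0 N b b' e f W') (hbad' : ¬ (d0c1 N b e f W' ∧ d0c2 N b b' e f W'))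
    (hxW' : x ∈ (W'.erase b).erase e) : W = W' := by
  have hXE : ((((gr N).erase b).erase b').erase f).erase e ⊆ ((gr N).erase b).erase b' :=
    (erase_subset _ _).trans (erase_subset _ _)
  have hXg : ((((gr N).erase b).erase b').erase f).erase e ⊆ gr N :=
    hXE.trans ((erase_subset _ _).trans (erase_subset _ _))
  have heE : e ∈ ((gr N).erase b).erase b' := mem_erase.2 ⟨heb', mem_erase.2 ⟨heb, he⟩⟩
  have hy1 : rk N ({y} : Finset α) = 1 := by
    have h1 := rk_insert_le_add_one (N := N) he (X := ({y} : Finset α)) (singleton_subset_iff.2 (hXg hyX))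
    have h2 := rk_le_card' (M := N) ({y} : Finset α)
    rw [card_singleton] at h2
    rw [he1 y hyX] at h1
    omega
  have hX5 := card_X_eq_five hn h he hf hef heb heb' hfb hfb'
  have hWd := hW
  simp only [d0DON, mem_filter] at hWd
  obtain ⟨-, hπX, hπ2, hπW, hbW, hπe, -, hon⟩ :=
    d0_demand_data h hn hf hef heb hfb hfb' (e := e) W hWd.1 hWd.2.1 hWd.2.2
  have hWd' := hW'
  simp only [d0DON, mem_filter] at hWd'
  obtain ⟨-, hπX', hπ2', hπW', hbW', hπe', -, hon'⟩ :=
    d0_demand_data h hn hf hef heb hfb hfb' (e := e) W' hWd'.1 hWd'.2.1 hWd'.2.2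
  have hyπ : rk N (insert y (insert e ((W.erase b).erase e))) = rk N (insert e ((W.erase b).erase e)) :=
    (on_iff_of_parallel h (hXE hyX) hy1 hpar hbb2 (insert_subset heE (hπX.trans hXE))).1 (by rw [hπe]; exact hon)
  have hyπ' : rk N (insert y (insert e ((W'.erase b).erase e))) = rk N (insert e ((W'.erase b).erase e)) :=
    (on_iff_of_parallel h (hXE hyX) hy1 hpar hbb2 (insert_subset heE (hπX'.trans hXE))).1 (by rw [hπe']; exact hon')
  by_cases hc1' : d0c1 N b e f W'
  · -- both have `c1`: the planes `π + e`, `π′ + e` both contain `x, e, y` of rank `3`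
    have hc2' : ¬ d0c2 N b b' e f W' := fun h' => hbad' ⟨hc1', h'⟩
    have hyW := parX_not_mem_of_c1 hn h he hf hef heb heb' hfb hfb' he1 hfc hyX hpar hbb2 hW hc0 hc1 hc2
    have hyW' := parX_not_mem_of_c1 hn h he hf hef heb heb' hfb hfb' he1 hfc hyX hpar hbb2 hW' hc0' hc1' hc2'
    obtain ⟨p, hpπ, hpx⟩ := exists_mem_ne (by omega : 1 < ((W.erase b).erase e).card) x
    obtain ⟨p', hpπ', hpx'⟩ := exists_mem_ne (by omega : 1 < ((W'.erase b).erase e).card) x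
    have hπeq : (W.erase b).erase e = {x, p} := eq_pair_of_card_two hπ2 hxW hpπ hpx.symm
    have hπeq' : (W'.erase b).erase e = {x, p'} := eq_pair_of_card_two hπ2' hxW' hpπ' hpx'.symm
    by_cases hpp : p = p'
    · rw [← hbW, ← hπW, hπeq, hpp, ← hπeq', hπW', hbW']
    exfalso
    -- `ρ{x, e, y} = 3`
    have hxey : rk N (insert y {e, x}) = 3 := by
      by_contra hne
      have h1 : rk N {e, x} ≤ rk N (insert y {e, x}) := rk_mono' (subset_insert _ _)
      have h2 := rk_insert_le_add_one (N := N) (hXg hyX) (X := {e, x}) (insert_subset he (singleton_subset_iff.2 (hXg hxX)))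
      rw [he1 x hxX] at h1 h2
      have h3 : rk N (insert y {e, x}) = rk N {e, x} := by rw [he1 x hxX]; omega
      have h4 := rk_insert_eq_of_rk_insert_eq_subset' (N := N) (S := {e, x}) (S' := {e, f, x}) (w := y) (by
        intro u hu; simp only [mem_insert, mem_singleton] at hu ⊢; tauto) h3
      rw [hoff, hefx] at h4
      omega
    have hpX := hπX hpπ
    have hpX' := hπX' hpπ'
    have hyx : y ≠ x := fun h' => hyW (h' ▸ hxW)
    have hyp : y ≠ p := fun h' => hyW (h' ▸ hpπ)
    have hyp' : y ≠ p' := fun h' => hyW' (h' ▸ hpπ')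
    -- the fifth point `u`
    have hcard4 : ({x, p, p', y} : Finset α).card = 4 := by
      rw [card_insert_of_notMem, card_insert_of_notMem, card_pair hyp'.symm]
      · simp only [mem_insert, mem_singleton, not_or]; exact ⟨hpp, hyp.symm⟩
      · simp only [mem_insert, mem_singleton, not_or]; exact ⟨hpx.symm, hpx'.symm, hyx.symm⟩
    have hsub4 : ({x, p, p', y} : Finset α) ⊆ ((((gr N).erase b).erase b').erase f).erase e := by
      intro u hu; simp only [mem_insert, mem_singleton] at hu
      rcases hu with rfl | rfl | rfl | rfl
      · exact hxX
      · exact hpX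
      · exact hpX'
      · exact hyX
    have hc1' : (((((gr N).erase b).erase b').erase f).erase e \ {x, p, p', y}).card = 1 := by
      rw [card_sdiff_of_subset hsub4, hX5, hcard4]
    obtain ⟨u, hu⟩ := card_eq_one.1 hc1'
    have huX : u ∈ ((((gr N).erase b).erase b').erase f).erase e := by
      have : u ∈ ((((gr N).erase b).erase b').erase f).erase e \ {x, p, p', y} := by rw [hu]; exact mem_singleton_self _
      exact (mem_sdiff.1 this).1
    have hU : insert e ((((((gr N).erase b).erase b').erase f).erase e).erase u) ⊆
        insert y (insert e ((W.erase b).erase e)) ∪ insert y (insert e ((W'.erase b).erase e)) := by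
      intro v hv
      rw [mem_insert] at hv
      rcases hv with rfl | hv
      · exact mem_union_left _ (mem_insert_of_mem (mem_insert_self _ _))
      have hvu := (mem_erase.1 hv).1
      have hvX := (mem_erase.1 hv).2
      have hv4 : v ∈ ({x, p, p', y} : Finset α) := by
        by_contra hv4
        have : v ∈ ((((gr N).erase b).erase b').erase f).erase e \ {x, p, p', y} := mem_sdiff.2 ⟨hvX, hv4⟩
        rw [hu, mem_singleton] at this
        exact hvu this
      simp only [mem_insert, mem_singleton] at hv4
      rcases hv4 with rfl | rfl | rfl | rfl
      · exact mem_union_left _ (mem_insert_of_mem (mem_insert_of_mem hxW))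
      · exact mem_union_left _ (mem_insert_of_mem (mem_insert_of_mem hpπ))
      · exact mem_union_right _ (mem_insert_of_mem (mem_insert_of_mem hpπ'))
      · exact mem_union_left _ (mem_insert_self _ _)
    have hI : insert y ({e, x} : Finset α) ⊆
        insert y (insert e ((W.erase b).erase e)) ∩ insert y (insert e ((W'.erase b).erase e)) := by
      intro v hv
      simp only [mem_insert, mem_singleton] at hv
      rcases hv with rfl | rfl | rfl
      · exact mem_inter.2 ⟨mem_insert_self _ _, mem_insert_self _ _⟩
      · exact mem_inter.2 ⟨mem_insert_of_mem (mem_insert_self _ _), mem_insert_of_mem (mem_insert_self _ _)⟩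
      · exact mem_inter.2 ⟨mem_insert_of_mem (mem_insert_of_mem hxW), mem_insert_of_mem (mem_insert_of_mem hxW')⟩
    have h1 := rk_union_add_rk_le_of_subset_inter' (N := N) hI
    have h2 := rk_mono' (M := N) hU
    rw [insert_e_X_erase_eq he hef heb heb' huX, hfc u huX] at h2
    rw [hxey, hyπ, hyπ', hπe, hπe'] at h1
    omega
  · -- `W′` without `c1`: `f ∈ cl(π′ + e)`, a plane through `e, f, x` containing `y`
    exfalso
    unfold d0c1 at hc1'
    have h1 := rk_insert_le_add_one (N := N) hf (X := insert e ((W'.erase b).erase e))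
      (insert_subset he (hπX'.trans hXg))
    have h2 : rk N (insert e ((W'.erase b).erase e)) ≤ rk N (insert f (insert e ((W'.erase b).erase e))) :=
      rk_mono' (subset_insert _ _)
    rw [hπe'] at h1 h2
    have h3 : rk N (insert f (insert e ((W'.erase b).erase e))) = 3 := by omega
    have h4 := rk_insert_eq_of_rk_insert_eq_subset' (N := N) (S := insert e ((W'.erase b).erase e))
      (S' := insert f (insert e ((W'.erase b).erase e))) (w := y) (subset_insert _ _) hyπ'
    rw [h3] at h4
    have h5 : rk N (insert y {e, f, x}) ≤ rk N (insert y (insert f (insert e ((W'.erase b).erase e)))) :=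
      rk_mono' (by
        intro v hv; simp only [mem_insert, mem_singleton] at hv
        rcases hv with rfl | rfl | rfl | rfl
        · exact mem_insert_self _ _
        · exact mem_insert_of_mem (mem_insert_of_mem (mem_insert_self _ _))
        · exact mem_insert_of_mem (mem_insert_self _ _)
        · exact mem_insert_of_mem (mem_insert_of_mem (mem_insert_of_mem hxW')))
    rw [h4, hoff] at h5
    omega

end StarSharpParXA

end PercRepro.Cogirth
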